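/-
Copyright (c) 2026. All rights reserved.
Released under Apache 2.0 license as described in the file LICENSE.
-/
import Literature.GroupTheory.FreeProcyclicQuotientLift
import Literature.AnabelianGeometry.AbsoluteAnabelian.FreeProcyclicCdOne
import Mathlib.Topology.Algebra.Group.Quotient
import Mathlib.Topology.Homeomorph.Lemmas
import HarnessLib

/-!
# A free procyclic quotient is split by the closed subgroup generated by any lift of a generator:
# `G = N ⋊ cl⟨φ⟩`, the continuous retraction `G → cl⟨φ⟩`, and `cl⟨φ⟩ ≅ G ⧸ N` is free procyclic

Topic `GroupTheory` (profinite groups); namespace `Literature.GroupTheory`.  THEOREMS ONLY (no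
definition, no named fact).

Let `G` be a profinite group, `N ⊴ G` a CLOSED normal subgroup such that `G ⧸ N` is FREE PROCYCLIC
(`Literature.AnabelianGeometry.AbsoluteAnabelian.FundamentalExtension.IsFreeProcyclic`: a dense cyclic
subgroup and an open subgroup of every positive index, "`≅ Ẑ`"), and let `φ ∈ G` be ANY element whose
image `φ̄` topologically generates `G ⧸ N`.  Write `C = cl⟨φ⟩` (`(zpowers φ).topologicalClosure`).  Then

* `topologicalClosure_zpowers_sup_eq_top_of_dense` — `C ⊔ N = ⊤` (`C · N` is closed and its image
  contains the dense `⟨φ̄⟩`);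
* `topologicalClosure_zpowers_inf_eq_bot_of_dense` — `C ⊓ N = ⊥` (the tree's
  `topologicalClosure_zpowers_inf_eq_bot_of_isFreeProcyclic`: a procyclic group mapping onto `Ẑ` does so
  isomorphically);
* `bijective_restrict_mk_topologicalClosure_zpowers` — `C → G ⧸ N` is a continuous bijective
  homomorphism, hence (compact to Hausdorff) a topological isomorphism;
* **`exists_continuousMonoidHom_retraction_of_isFreeProcyclic`** — there is a CONTINUOUS homomorphism
  `r : G → G` with values in `C`, equal to the identity on `C`, with kernel exactly `N`; consequently
  every `g ∈ G` is `g = n · c` with `n = g (r g)⁻¹ ∈ N`, `c = r g ∈ C`, continuously in `g`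
  ("`G = N ⋊ C`", the semidirect decomposition used to extend cocycles from `N` to `G`);
* `dense_zpowers_mk_topologicalClosure'`, `exists_isOpen_index_topologicalClosure_zpowers`,
  **`isFreeProcyclic_topologicalClosure_zpowers`** — `C` is itself free procyclic, topologically
  generated by `φ` (so the tree's `H¹(C, B) ≅ B/(φ − 1)B`, `FreeProcyclicHOneEval`, applies to `C`).

The model is `G = Γ_F` (a non-archimedean local field), `N = I_F` the inertia group, `φ` any
Frobenius lift: `Γ_F = I_F ⋊ cl⟨φ⟩` with `cl⟨φ⟩ ≅ Gal(F^nr/F) ≅ Ẑ` (Neukirch–Schmidt–Wingberg,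
(7.5.2)–(7.5.3); Iwasawa).  Classical profinite group theory; the only input beyond the tree's lemma is
point-set topology of compact groups. [cite: RibesZalesskii2010, §2.5] [cite: NeukirchSchmidtWingberg2008, Thm. 7.5.3]
-/

noncomputable section

open scoped Pointwise

universe u

namespace Literature.GroupTheory

open _root_.Subgroup Topology
open Literature.AnabelianGeometry.AbsoluteAnabelian

variable {G : Type u} [Group G] [TopologicalSpace G] [IsTopologicalGroup G] [CompactSpace G]
  [T2Space G] [TotallyDisconnectedSpace G]

omit [CompactSpace G] [T2Space G] [TotallyDisconnectedSpace G] in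
/-- The cyclic subgroup generated by `φ` is dense in `cl⟨φ⟩` (subspace topology): the element
`φ ∈ cl⟨φ⟩` topologically generates `cl⟨φ⟩` (a procyclic group is topologically generated by its
generator). [cite: RibesZalesskii2010, §2.5] -/
theorem dense_zpowers_mk_topologicalClosure' (φ : G) :
    Dense (zpowers (⟨φ, le_topologicalClosure _ (mem_zpowers φ)⟩ :
      (zpowers φ).topologicalClosure) : Set (zpowers φ).topologicalClosure) := by
  set Ψ := (zpowers φ).topologicalClosure
  set ψ' : Ψ := ⟨φ, le_topologicalClosure _ (mem_zpowers φ)⟩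
  rw [Topology.IsInducing.subtypeVal.dense_iff]
  intro x
  have himage : Subtype.val '' (zpowers ψ' : Set Ψ) = (zpowers φ : Set G) := by
    ext y
    constructor
    · rintro ⟨z, ⟨n, rfl⟩, rfl⟩
      exact ⟨n, by simp [ψ']⟩
    · rintro ⟨n, rfl⟩
      exact ⟨ψ' ^ n, ⟨n, rfl⟩, by simp [ψ']⟩
  have hx : (x : G) ∈ _root_.closure (zpowers φ : Set G) := by
    rw [← topologicalClosure_coe]; exact x.2
  convert hx using 2
  exact himage

omit [TotallyDisconnectedSpace G] in
/-- **`cl⟨φ⟩ ⊔ N = ⊤`** for a closed normal subgroup `N` of a compact group `G` and any `φ` whose image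
generates a dense subgroup of `G ⧸ N`: the subgroup `cl⟨φ⟩ · N` is closed (compact times compact) and
its image in `G ⧸ N` is closed and contains `⟨φ̄⟩`. [cite: NeukirchSchmidtWingberg2008, Thm. 7.5.3] -/
theorem topologicalClosure_zpowers_sup_eq_top_of_dense (N : Subgroup G) [N.Normal]
    (hN : IsClosed (N : Set G)) (φ : G)
    (hφ : Dense (zpowers (QuotientGroup.mk φ : G ⧸ N) : Set (G ⧸ N))) :
    (zpowers φ).topologicalClosure ⊔ N = ⊤ := by
  classical
  set M : Subgroup G := (zpowers φ).topologicalClosure ⊔ N with hM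
  have hMc : IsClosed (M : Set G) := by
    rw [hM, mul_normal]
    exact ((isClosed_topologicalClosure _).isCompact.mul hN.isCompact).isClosed
  have himc : IsClosed ((QuotientGroup.mk : G → G ⧸ N) '' (M : Set G)) :=
    (hMc.isCompact.image QuotientGroup.continuous_mk).isClosed
  have hsub : (zpowers (QuotientGroup.mk φ : G ⧸ N) : Set (G ⧸ N)) ⊆
      (QuotientGroup.mk : G → G ⧸ N) '' (M : Set G) := by
    rintro _ ⟨n, rfl⟩
    exact ⟨φ ^ n, mem_sup_left (le_topologicalClosure _ ⟨n, rfl⟩), by simp⟩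
  have hall : (QuotientGroup.mk : G → G ⧸ N) '' (M : Set G) = Set.univ := by
    apply Set.eq_univ_of_univ_subset
    rw [← hφ.closure_eq]
    exact closure_minimal hsub himc
  rw [eq_top_iff]
  intro g _
  obtain ⟨m, hm, hmg⟩ := (Set.eq_univ_iff_forall.mp hall) (QuotientGroup.mk g)
  rw [QuotientGroup.eq] at hmg
  have : g = m * (m⁻¹ * g) := by rw [mul_inv_cancel_left]
  rw [this]
  exact mul_mem hm (mem_sup_right hmg)

/-- **`cl⟨φ⟩ ⊓ N = ⊥`** when moreover `G ⧸ N` is free procyclic: a procyclic supplement of a free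
procyclic quotient meets the kernel trivially (tree
`topologicalClosure_zpowers_inf_eq_bot_of_isFreeProcyclic`). [cite: RibesZalesskii2010, §2.5] -/
theorem topologicalClosure_zpowers_inf_eq_bot_of_dense (N : Subgroup G) [N.Normal]
    (hN : IsClosed (N : Set G)) (hfree : FundamentalExtension.IsFreeProcyclic (G ⧸ N)) (φ : G)
    (hφ : Dense (zpowers (QuotientGroup.mk φ : G ⧸ N) : Set (G ⧸ N))) :
    (zpowers φ).topologicalClosure ⊓ N = ⊥ :=
  topologicalClosure_zpowers_inf_eq_bot_of_isFreeProcyclic N hfree φ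
    (topologicalClosure_zpowers_sup_eq_top_of_dense N hN φ hφ)

omit [TotallyDisconnectedSpace G] [T2Space G] [CompactSpace G] [TopologicalSpace G] [IsTopologicalGroup G] in
/-- The projection `cl⟨φ⟩ → G ⧸ N` is surjective as soon as `cl⟨φ⟩ ⊔ N = ⊤`. [folklore] -/
private theorem surjective_restrict_mk_of_sup_eq_top (N : Subgroup G) [N.Normal] (C : Subgroup G)
    (hsup : C ⊔ N = ⊤) : Function.Surjective ((QuotientGroup.mk' N).restrict C) := by
  rintro ⟨x⟩
  have hx : x ∈ ((C ⊔ N : Subgroup G) : Set G) := by rw [hsup]; exact Set.mem_univ x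
  rw [mul_normal] at hx
  obtain ⟨y, hy, g, hg, rfl⟩ := Set.mem_mul.mp hx
  refine ⟨⟨y, hy⟩, ?_⟩
  change (QuotientGroup.mk y : G ⧸ N) = QuotientGroup.mk (y * g)
  rw [QuotientGroup.eq, ← mul_assoc, inv_mul_cancel, one_mul]
  exact hg

omit [TotallyDisconnectedSpace G] [T2Space G] [CompactSpace G] [IsTopologicalGroup G] [TopologicalSpace G] in
/-- The projection `C → G ⧸ N` is injective as soon as `C ⊓ N = ⊥`. [folklore] -/
private theorem injective_restrict_mk_of_inf_eq_bot (N : Subgroup G) [N.Normal] (C : Subgroup G)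
    (hinf : C ⊓ N = ⊥) : Function.Injective ((QuotientGroup.mk' N).restrict C) := by
  rw [← MonoidHom.ker_eq_bot_iff, eq_bot_iff]
  intro c hc
  rw [MonoidHom.mem_ker, MonoidHom.restrict_apply, QuotientGroup.mk'_apply,
    QuotientGroup.eq_one_iff] at hc
  have : (c : G) ∈ C ⊓ N := ⟨c.2, hc⟩
  rw [hinf, mem_bot] at this
  exact Subtype.ext this

/-- **`cl⟨φ⟩ → G ⧸ N` is a continuous bijective homomorphism** (for `N` closed, `G ⧸ N` free procyclic,
`φ̄` a topological generator). [cite: RibesZalesskii2010, §2.5] -/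
theorem bijective_restrict_mk_topologicalClosure_zpowers (N : Subgroup G) [N.Normal]
    (hN : IsClosed (N : Set G)) (hfree : FundamentalExtension.IsFreeProcyclic (G ⧸ N)) (φ : G)
    (hφ : Dense (zpowers (QuotientGroup.mk φ : G ⧸ N) : Set (G ⧸ N))) :
    Function.Bijective ((QuotientGroup.mk' N).restrict (zpowers φ).topologicalClosure) :=
  ⟨injective_restrict_mk_of_inf_eq_bot N _ (topologicalClosure_zpowers_inf_eq_bot_of_dense N hN hfree φ hφ),
    surjective_restrict_mk_of_sup_eq_top N _ (topologicalClosure_zpowers_sup_eq_top_of_dense N hN φ hφ)⟩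

/-- **The continuous retraction `G → cl⟨φ⟩` with kernel `N` ("`G = N ⋊ cl⟨φ⟩`").** For `G` profinite,
`N ⊴ G` closed with `G ⧸ N` free procyclic, and `φ ∈ G` whose image topologically generates `G ⧸ N`,
there is a continuous homomorphism `r : G → G` taking values in `C = cl⟨φ⟩`, restricting to the
identity on `C`, and with `r g = 1 ↔ g ∈ N`; it is `G → G ⧸ N ≅ C ↪ G`, the middle isomorphism being
the inverse of the continuous bijection `C → G ⧸ N` from a compact to a Hausdorff group.
[cite: NeukirchSchmidtWingberg2008, Thm. 7.5.3] [cite: RibesZalesskii2010, §2.5] -/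
theorem exists_continuousMonoidHom_retraction_of_isFreeProcyclic (N : Subgroup G) [N.Normal]
    (hN : IsClosed (N : Set G)) (hfree : FundamentalExtension.IsFreeProcyclic (G ⧸ N)) (φ : G)
    (hφ : Dense (zpowers (QuotientGroup.mk φ : G ⧸ N) : Set (G ⧸ N))) :
    ∃ r : G →ₜ* G, (∀ g, r g ∈ (zpowers φ).topologicalClosure) ∧
      (∀ c ∈ (zpowers φ).topologicalClosure, r c = c) ∧ (∀ g, r g = 1 ↔ g ∈ N) := by
  classical
  set C : Subgroup G := (zpowers φ).topologicalClosure with hCdef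
  have hCc : IsClosed (C : Set G) := isClosed_topologicalClosure _
  haveI : CompactSpace C := isCompact_iff_compactSpace.mp hCc.isCompact
  haveI : IsClosed (N : Set G) := hN
  haveI : T2Space (G ⧸ N) := inferInstance
  let f : C →* G ⧸ N := (QuotientGroup.mk' N).restrict C
  have hfcont : Continuous f := QuotientGroup.continuous_mk.comp continuous_subtype_val
  have hf : Function.Bijective f := bijective_restrict_mk_topologicalClosure_zpowers N hN hfree φ hφ
  let e : C ≃* G ⧸ N := MulEquiv.ofBijective f hf
  have hecont : Continuous e := hfcont
  have hesymm : Continuous e.symm := by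
    have h := Continuous.continuous_symm_of_equiv_compact_to_t2 (f := e.toEquiv) hecont
    exact h
  let r : G →ₜ* G :=
    ⟨(C.subtype.comp e.symm.toMonoidHom).comp (QuotientGroup.mk' N),
      continuous_subtype_val.comp (hesymm.comp QuotientGroup.continuous_mk)⟩
  have hr : ∀ g, r g = ((e.symm (QuotientGroup.mk g) : C) : G) := fun _ => rfl
  refine ⟨r, fun g => by rw [hr]; exact (e.symm _).2, fun c hc => ?_, fun g => ?_⟩
  · rw [hr]
    have : e.symm (QuotientGroup.mk c) = ⟨c, hc⟩ := by
      apply e.injective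
      rw [MulEquiv.apply_symm_apply]
      rfl
    rw [this]
  · rw [hr]
    constructor
    · intro h
      have h1 : e.symm (QuotientGroup.mk g) = 1 := Subtype.ext (by simpa using h)
      have h2 : (QuotientGroup.mk g : G ⧸ N) = 1 := by
        rw [← MulEquiv.apply_symm_apply e (QuotientGroup.mk g), h1, map_one]
      exact (QuotientGroup.eq_one_iff g).mp h2
    · intro hg
      have h2 : (QuotientGroup.mk g : G ⧸ N) = 1 := (QuotientGroup.eq_one_iff g).mpr hg
      rw [h2, map_one]
      rfl

omit [CompactSpace G] [T2Space G] [TotallyDisconnectedSpace G] [IsTopologicalGroup G] in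
/-- Consequences of a retraction `r` onto `C` with kernel `N`: `g · (r g)⁻¹ ∈ N`, so that
`g = (g (r g)⁻¹) · (r g)` with the first factor in `N` and the second in `C` — the semidirect
decomposition `G = N ⋊ C`. [cite: NeukirchSchmidtWingberg2008, Thm. 7.5.3] -/
theorem mul_inv_retraction_mem {N C : Subgroup G} (r : G →ₜ* G) (hrC : ∀ g, r g ∈ C)
    (hrid : ∀ c ∈ C, r c = c) (hker : ∀ g, r g = 1 ↔ g ∈ N) (g : G) : g * (r g)⁻¹ ∈ N := by
  rw [← hker, map_mul, map_inv, hrid _ (hrC g), mul_inv_cancel]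

omit [CompactSpace G] [T2Space G] [TotallyDisconnectedSpace G] [IsTopologicalGroup G] in
/-- A retraction with kernel `N` kills `N`. [cite: NeukirchSchmidtWingberg2008, Thm. 7.5.3] -/
theorem retraction_eq_one_of_mem {N C : Subgroup G} (r : G →ₜ* G) (_hrC : ∀ g, r g ∈ C)
    (hker : ∀ g, r g = 1 ↔ g ∈ N) {n : G} (hn : n ∈ N) : r n = 1 :=
  (hker n).mpr hn

omit [CompactSpace G] [T2Space G] [TotallyDisconnectedSpace G] [IsTopologicalGroup G] in
/-- Uniqueness of the decomposition `g = n · c` (`n ∈ N`, `c ∈ C`) given a retraction with kernel `N`: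
the `C`-component is `r g` (`G = N ⋊ C`). [cite: NeukirchSchmidtWingberg2008, Thm. 7.5.3] -/
theorem retraction_eq_of_mul_mem {N C : Subgroup G} (r : G →ₜ* G) (_hrC : ∀ g, r g ∈ C)
    (hrid : ∀ c ∈ C, r c = c) (hker : ∀ g, r g = 1 ↔ g ∈ N) {g n c : G} (hn : n ∈ N) (hc : c ∈ C)
    (h : g = n * c) : r g = c := by
  rw [h, map_mul, (hker n).mpr hn, one_mul, hrid c hc]

omit [TotallyDisconnectedSpace G] in
/-- **`cl⟨φ⟩` has an open subgroup of every positive index** (pull back the one of `G ⧸ N` along the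
continuous surjection `cl⟨φ⟩ → G ⧸ N`). [cite: RibesZalesskii2010, §2.5] -/
theorem exists_isOpen_index_topologicalClosure_zpowers (N : Subgroup G) [N.Normal]
    (hN : IsClosed (N : Set G)) (hfree : FundamentalExtension.IsFreeProcyclic (G ⧸ N)) (φ : G)
    (hφ : Dense (zpowers (QuotientGroup.mk φ : G ⧸ N) : Set (G ⧸ N))) (n : ℕ) (hn : 0 < n) :
    ∃ H : Subgroup (zpowers φ).topologicalClosure,
      IsOpen (H : Set (zpowers φ).topologicalClosure) ∧ H.index = n := by
  set C : Subgroup G := (zpowers φ).topologicalClosure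
  let f : C →* G ⧸ N := (QuotientGroup.mk' N).restrict C
  have hfcont : Continuous f := QuotientGroup.continuous_mk.comp continuous_subtype_val
  have hfsurj : Function.Surjective f :=
    surjective_restrict_mk_of_sup_eq_top N C (topologicalClosure_zpowers_sup_eq_top_of_dense N hN φ hφ)
  obtain ⟨H, hHo, hHidx⟩ := hfree.exists_isOpen_index n hn
  exact ⟨H.comap f, hHo.preimage hfcont, by rw [index_comap_of_surjective _ hfsurj, hHidx]⟩

omit [TotallyDisconnectedSpace G] in
/-- **`cl⟨φ⟩` is free procyclic, topologically generated by `φ`** (`≅ G ⧸ N ≅ Ẑ`).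
[cite: RibesZalesskii2010, §2.5] -/
theorem isFreeProcyclic_topologicalClosure_zpowers (N : Subgroup G) [N.Normal]
    (hN : IsClosed (N : Set G)) (hfree : FundamentalExtension.IsFreeProcyclic (G ⧸ N)) (φ : G)
    (hφ : Dense (zpowers (QuotientGroup.mk φ : G ⧸ N) : Set (G ⧸ N))) :
    FundamentalExtension.IsFreeProcyclic (zpowers φ).topologicalClosure :=
  ⟨⟨_, dense_zpowers_mk_topologicalClosure' φ⟩,
    exists_isOpen_index_topologicalClosure_zpowers N hN hfree φ hφ⟩

omit [CompactSpace G] [T2Space G] [TotallyDisconnectedSpace G] in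
/-- **Density of `N · ⟨φ⟩` in `G`**: if `φ̄` topologically generates `G ⧸ N`, the set of products
`n φ^k` (`n ∈ N`, `k ∈ ℤ`) is dense in `G` (the preimage of a dense set under the open quotient map):
`N` and `φ` topologically generate `G`. [cite: NeukirchSchmidtWingberg2008, Thm. 7.5.3] -/
theorem dense_mul_zpowers_of_dense (N : Subgroup G) [N.Normal] (φ : G)
    (hφ : Dense (zpowers (QuotientGroup.mk φ : G ⧸ N) : Set (G ⧸ N))) :
    Dense ((N : Set G) * (zpowers φ : Set G)) := by
  rw [dense_iff_inter_open]
  intro U hU ⟨g, hg⟩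
  have hUo : IsOpen ((QuotientGroup.mk : G → G ⧸ N) '' U) := QuotientGroup.isOpenMap_coe U hU
  obtain ⟨_, hyU, ⟨k, rfl⟩⟩ := hφ.inter_open_nonempty _ hUo ⟨QuotientGroup.mk g, g, hg, rfl⟩
  obtain ⟨u, hu, hux⟩ := hyU
  change (QuotientGroup.mk u : G ⧸ N) = (QuotientGroup.mk φ : G ⧸ N) ^ k at hux
  rw [← QuotientGroup.mk_zpow, QuotientGroup.eq] at hux
  -- `u = (u φ^{-k}) φ^k` with `u φ^{-k} ∈ N`? we have `u⁻¹ φ^k ∈ N`, so `u = φ^k (u⁻¹φ^k)⁻¹`;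
  -- use normality: `u = (φ^k (u⁻¹ φ^k)⁻¹ φ^{-k}) φ^k`.
  refine ⟨u, hu, ?_⟩
  refine Set.mem_mul.mpr ⟨φ ^ k * (u⁻¹ * φ ^ k)⁻¹ * (φ ^ k)⁻¹, ?_, φ ^ k, ⟨k, rfl⟩, ?_⟩
  · exact Subgroup.Normal.conj_mem inferInstance _ (inv_mem hux) _
  · group

end Literature.GroupTheory

end
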